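import Summits.ResolutionOfSingularities.ResolutionOfSingularities.Theorems.HilbertSamuelEliminationSigmaMaxModificationsCorridor3WLadderMovingAlt
import Summits.ResolutionOfSingularities.ResolutionOfSingularities.Theorems.HilbertSamuelEliminationSigmaMaxModificationsCorridor3WLadderIsoTransitionBirth
import Summits.ResolutionOfSingularities.ResolutionOfSingularities.Theorems.HilbertSamuelEliminationSigmaMaxModificationsCorridor3WLadderForcedGameTowersJoin
import Summits.ResolutionOfSingularities.ResolutionOfSingularities.Theorems.HilbertSamuelEliminationSigmaMaxModificationsCorridor3WLadderIsoProximity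
import HarnessLib

/-!
# [OURS · L1 W4.2] MODULE `Corridor3WLadderWtopPointedCloser` (crux chain w42) — the POINTED W-top stub's closer, fully spelled out

The by-name CENSUS of the registered stub `stub_Wtop3M_pointed : ∀ p, p.Prime → Wtop3PointedM p` after DEALS D2/D5/D7/D14/D15/D16/D17 and the
k21 verdict (res-L1-w42-plan-1 RULINGS v3.12-4 (V) «pointed row decomposition of record», v3.13-5 (AT) «pointed row: kernel D14/D15 +
EvNonIso@QPointed + ALT D16/D17 — open in the model»).  Every theorem here is a JOIN BY NAME of landed pieces — D16 `wtop3PointedM_of_kernel`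
(p519348), D17 `Moving.wtopAltM_of_noRecurrentIsoPointBirth3` (res-type-067, p518912), the C4 floor `IdeasL1C4.isoQuadraticTowerTerminates_of_algIsolated`
(p516568: K-FORCED res-type-022 ∘ D5 res-D-pv-010 ∘ D2), the C5 cover `IdeasL1C5.isoQuadraticTowerTerminates_of_four` (p518905) — so that the
HONEST FLOOR of the pointed stub reads as ONE implication from NAMED open rows:

  `Wtop3PointedM p ⟸ AlgIsolatedOfIsolated (P1, DEAL D15) ∧ IsoTranslationTowersImpossible p (T3: = K1 (D14) ⊔ K2 ⊔ K3 by C5)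
                     ∧ WtopEvNonIsoM p QPointed (card H product at pointed origins: (T) ✓ p514855, (K) D6, (b)₃/(c-rep)₃ @ QPointed)
                     ∧ Moving.IsoTransitionLaw3 p QPointed (D17 (i)) ∧ Moving.NoRecurrentIsoPointBirth3 p QPointed (the eventual birth law, OPEN)`

(`wtop3PointedM_of_floor`), with the C5 variant (`wtop3PointedM_of_floor_proximity`: K1/K2-sep/K3-sep/(k2) in place of P1 ∧ T3).  Nothing here is new
mathematics; nothing credits the crux (helper lemmas, `--supports stmt-…-19249 --as helper`, counted 0).  The NON-pointed stub is FROZEN (k21) and has no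
closer here.  OURS; NOT statements of [CossartJannsenSaito2020] nor of the manuscript [Hironaka2017]; AI typing, weaker than expert review.
-/

set_option linter.dupNamespace false

open CategoryTheory AlgebraicGeometry TopologicalSpace
open Summit.ResolutionOfSingularities.ResolutionOfSingularities.Theorems.CampaignW42
open Summit.ResolutionOfSingularities.ResolutionOfSingularities.Theorems.SigmaMaxModificationsCorridor3
open Summit.ResolutionOfSingularities.ResolutionOfSingularities.Theorems.SigmaMaxModificationsCorridor3.Moving
open Summit.ResolutionOfSingularities.ResolutionOfSingularities.Theorems.SigmaMaxModificationsCorridor3.Helpers (QPointed)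
open Summit.ResolutionOfSingularities.ResolutionOfSingularities.Cruxes.SigmaMaxModifications

namespace Summit.ResolutionOfSingularities.ResolutionOfSingularities.Cruxes.SigmaMaxModifications.IdeasL1Idea2R4

universe u

/-- **The pointed stub from the kernel, Ev-NonIso and the two BIRTH LAWS of D17** (ALT discharged by res-type-067's
`Moving.wtopAltM_of_noRecurrentIsoPointBirth3`). OURS join; not a citation of print. -/
theorem wtop3PointedM_of_kernel_of_birthLaws {p : ℕ} (hT : IsoQuadraticTowerTerminates.{u} p 3)
    (hev : WtopEvNonIsoM.{u} p QPointed) (hlaw : Moving.IsoTransitionLaw3.{u} p QPointed)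
    (hrec : Moving.NoRecurrentIsoPointBirth3.{u} p QPointed) : Wtop3PointedM.{u} p :=
  wtop3PointedM_of_kernel hT hev (Moving.wtopAltM_of_noRecurrentIsoPointBirth3 hlaw hrec)

/-- **THE HONEST FLOOR OF `stub_Wtop3M_pointed` IN ONE IMPLICATION (frame route, card C4):** the pointed W-top row from P1 (`AlgIsolatedOfIsolated`,
DEAL D15), the residual core T3 (`IsoTranslationTowersImpossible p`), Ev-NonIso at pointed origins, and D17's transition law + eventual birth law at
pointed origins — the kernel entering through the C4 floor `IdeasL1C4.isoQuadraticTowerTerminates_of_algIsolated` (K-FORCED ∘ D5 ∘ D2, p516568).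
OURS join; not a citation of print. -/
theorem wtop3PointedM_of_floor {p : ℕ} (hP1 : IdeasL1C4.AlgIsolatedOfIsolated.{u}) (h3 : IdeasL1C4.IsoTranslationTowersImpossible.{u} p)
    (hev : WtopEvNonIsoM.{u} p QPointed) (hlaw : Moving.IsoTransitionLaw3.{u} p QPointed)
    (hrec : Moving.NoRecurrentIsoPointBirth3.{u} p QPointed) : Wtop3PointedM.{u} p :=
  wtop3PointedM_of_kernel_of_birthLaws (IdeasL1C4.isoQuadraticTowerTerminates_of_algIsolated p hP1 h3) hev hlaw hrec

/-- **The same floor through the proximity trichotomy (card C5):** K1 (free-rational tails, DEAL D14), (k2) `IsoInsepTowerTerminates`, and the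
separable-restricted K2/K3, in place of P1 ∧ T3 (`IdeasL1C5.isoQuadraticTowerTerminates_of_four`, p518905). OURS join; not a citation of print. -/
theorem wtop3PointedM_of_floor_proximity {p : ℕ} (h1 : IdeasL1C5.IsoFreeRationalTailsImpossible.{u} p 3)
    (hI : IdeasL1C5.IsoInsepTowerTerminates.{u} p 3) (h2 : IdeasL1C5.IsoSepJumpRecurrentImpossible.{u} p 3)
    (h3 : IdeasL1C5.IsoSepSatelliteRecurrentImpossible.{u} p 3)
    (hev : WtopEvNonIsoM.{u} p QPointed) (hlaw : Moving.IsoTransitionLaw3.{u} p QPointed)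
    (hrec : Moving.NoRecurrentIsoPointBirth3.{u} p QPointed) : Wtop3PointedM.{u} p :=
  wtop3PointedM_of_kernel_of_birthLaws (IdeasL1C5.isoQuadraticTowerTerminates_of_four h1 hI h2 h3) hev hlaw hrec

end Summit.ResolutionOfSingularities.ResolutionOfSingularities.Cruxes.SigmaMaxModifications.IdeasL1Idea2R4
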